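import Mathlib
import Literature.Probability.RandomPlanarGeometry.ImaginaryGeometryHarmonic
import Literature.Probability.RandomPlanarGeometry.NestingTransform
import Literature.Probability.RandomPlanarGeometry.DirichletGFF
import Literature.Probability.Percolation.FullPlaneCNL
import Literature.Probability.Percolation.CLE6

/-!
# Sketch — crux-ideate stmt-CriticalPhenomena-4836 (MagicFormulaT), ideator 3, round 1

First-lemma signatures of the two idea cards, over existing declarations only.
Nothing here is proved; every `def … : Prop` must elaborate.
-/

noncomputable section

open MeasureTheory Set Filter Complex
open scoped Real NNReal Topology

namespace Summit.CriticalPhenomena.CardyFormulaZ2.Cruxes.MagicFormulaT.Sketch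

open Literature.Probability.RandomPlanarGeometry
open Literature.Probability.Percolation Literature.Probability.LatticeModels
open Literature.Probability.Process (preWienerMeasure brownian)

/-! ## Card `ig-unit-gap-martingale` -/

/-- The two exact constants behind the card: with DKLM's variance `σ² = 3/π` (Green function
`-(1/2π) log`), the imaginary-geometry field `a h`, `a² = σ²/2π = 3/(2π²)`, has height gap
`a · 2λ(6) = 1` across every SLE₆/CLE₆ counterflow loop (`λ(6) = π/√6 = λ'(8/3)`), and at
`κ = 6` alone the winding monodromy equals the gap: `-π χ(6) = λ(6)` (`χ(6) = -1/√6`). -/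
def UnitGap : Prop :=
  Real.sqrt (3 / (2 * π ^ 2)) * (2 * igLambda 6) = 1 ∧ -(π * igChi 6) = igLambda 6

/-- The stopping time "some point of the closed support strip `{Im z ≥ m, ‖z‖ ≤ R}` comes
`δ`-close to the driving point": infimum of the tree's approach times. -/
def supportApproachTime (U : ℝ≥0 → ℝ) (m R δ : ℝ) : WithTop ℝ≥0 :=
  ⨅ z ∈ {z : ℂ | m ≤ z.im ∧ ‖z‖ ≤ R}, Loewner.approachTime U z δ

/-- **First lemma (card `ig-unit-gap-martingale`): the Coulomb-gas candidate is the IG Doob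
martingale, with the MAGIC variance.**  For chordal SLE₆ in `ℍ` (the tree's SLE(κ,ρ) pair with
`κ = 6`, `ρ = 0`) and every bounded measurable `f` supported in `{Im z ≥ m > 0, ‖z‖ ≤ R}` with
`∫ f = 0`, the complex process
`M_t = exp( i a ∫ 𝔥_t(z) f(z) dz - (a²/2) ∬ G_ℍ(g_t z, g_t w) f(z) f(w) dz dw )`,
`a = √(3/(2π²))`, `a²/2 = 3/(4π²)`, `G_ℍ(z,w) = log|z - w̄| - log|z - w|` (the tree's
`upperHalfPlaneGreen`, `= 2π ×` DKLM's Green function, so that `a² G_ℍ = σ² G_DKLM` with the magic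
`σ² = 3/π`), stopped when the support comes `δ`-close to the tip, is a local martingale.
Itô (with `dW = √6 dB`): the drift vanishes iff the coefficient of `arg(g_t z - W_t)` is
`1/π = a·2λ(6)/π` and that of `arg g_t'(z)` is `-1/(2π)` — both forced by the magic variance and
both equal to IG's `a·𝔥_t`. [conjecture: this card; cite: MillerSheffield2016 Thm 1.1 — it is the
conditional characteristic function of the coupled GFF tested against `f`] -/
def IGMagicMartingale : Prop :=
  ∀ O W : ℝ≥0 → (ℝ≥0 → ℝ) → ℝ, IsSLEKappaRhoPair 6 0 O W →
    ∀ (f : ℂ → ℝ) (m R C δ : ℝ), 0 < m → 0 < δ → Measurable f → (∀ z, |f z| ≤ C) →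
      (∀ z, (z.im < m ∨ R < ‖z‖) → f z = 0) → ∫ z, f z = 0 →
      let M : ℝ≥0 → (ℝ≥0 → ℝ) → ℂ := fun t ω ↦
        Complex.exp
          (I * (Real.sqrt (3 / (2 * π ^ 2)) *
                ∫ z, imaginaryHarmonic 6 0 (fun s ↦ W s ω) (fun s ↦ O s ω) z t * f z)
            - (3 / (4 * π ^ 2) : ℝ) *
                ∫ z, ∫ w, upperHalfPlaneGreen (Loewner.map (fun s ↦ W s ω) t z)
                    (Loewner.map (fun s ↦ W s ω) t w) * f z * f w)
      let τ : (ℝ≥0 → ℝ) → WithTop ℝ≥0 := fun ω ↦ supportApproachTime (fun s ↦ W s ω) m R δ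
      IsLocalMartingale (stoppedProcess (fun t ω ↦ (M t ω).re) τ) brownianFiltration
          preWienerMeasure ∧
        IsLocalMartingale (stoppedProcess (fun t ω ↦ (M t ω).im) τ) brownianFiltration
          preWienerMeasure

/-- The continuum content of the crux, in the tree's words: the nesting transform of the
full-plane Camia–Newman CLE₆ law exists and is the Gaussian functional (the card reduces
MagicFormulaT to this plus `TransferContinuity`-type continuity on `𝕋` alone). -/
def CLE6MagicFormula : Prop :=
  exists_isFullPlaneCNLLaw →
    ∀ (f : ℂ → ℝ) (R C : ℝ), Measurable f → (∀ z, |f z| ≤ C) → (∀ z, R < ‖z‖ → f z = 0) →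
      ∫ z, f z = 0 →
      HasNestingTransform volume fullPlaneCNLLaw f
        (Real.exp (3 / (4 * π ^ 2) * ∫ x, ∫ y, Real.log ‖x - y‖ * f x * f y))

/-- **Cheapest falsifier of the card, lattice form (boundary blindness for Laplacian test
functions).** IG ⇒ for `f = Δg`, `g ∈ C_c²`, the twisted nesting transform in ANY simply connected
region with monochromatic boundary containing `supp g` equals the full-plane value. Lattice
shadow on `𝕋` (site percolation at 1/2, loops of the FULL-PLANE configuration versus loops of the
configuration made monochromatic (all sites open) outside the ball `B(0, ρ)`): the two transforms
have the same limit whenever `supp g ⊆ B(0, ρ/2)`. -/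
def LaplacianBoundaryBlindness : Prop :=
  ∀ (g : ℂ → ℝ) (ρ : ℝ), ContDiff ℝ 2 g → (∀ z, ρ / 2 < ‖z‖ → g z = 0) → 0 < ρ →
    let f : ℂ → ℝ := fun z ↦ (fderiv ℝ (fun w ↦ fderiv ℝ g w 1) z 1) + (fderiv ℝ (fun w ↦ fderiv ℝ g w I) z I)
    ∀ Λ : ℝ,
      Tendsto (fun δ : ℝ ↦ ∫ cfg, (∏ᶠ u ∈ {u : UnbasedLoop ℂ | ∃ (v : HexVertex)
          (γ : hexGraph.Walk v v), IsSiteInterfaceLoop cfg γ ∧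
            u = UnbasedLoop.mk (BasedLoop.mk (siteLoopCurve δ γ) (isLoop_siteLoopCurve δ γ))},
          u.nestingFactor f) ∂(triSitePercolation half)) (𝓝[>] 0) (𝓝 Λ) ↔
      Tendsto (fun δ : ℝ ↦ ∫ cfg, (∏ᶠ u ∈ {u : UnbasedLoop ℂ | ∃ (v : HexVertex)
          (γ : hexGraph.Walk v v),
            IsSiteInterfaceLoop (fun x ↦ cfg x ∨ ρ < ‖(δ : ℂ) * hexCenter ⟨x, 0⟩‖) γ ∧
            u = UnbasedLoop.mk (BasedLoop.mk (siteLoopCurve δ γ) (isLoop_siteLoopCurve δ γ))},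
          u.nestingFactor f) ∂(triSitePercolation half)) (𝓝[>] 0) (𝓝 Λ)

/-! ## Card `ik19-combinatorial-cylinder` -/

/-- **First lemma (card `ik19-combinatorial-cylinder`): the `k = 2` shadow of MagicFormulaT with
its constant.**  Second `t`-derivative at `t = 0` of both sides of the magic formula for `t f`:
with `N_f := Σ_u ∫_{int u} f` (the `f`-smeared nesting count) and `K_f := Σ_u (∫_{int u} f)²`
(the `f ⊗ f`-smeared common-loop count), site-`𝕋` percolation satisfies
`3·E[N_f²] - 4·E[K_f] → (3/(2π²)) ∬ log|x-y| f(x) f(y)` as `δ → 0⁺` (`∫ f = 0`).  This is the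
exact two-point twisted height function `Φ₂ → σ² Ψ₂^GFF`, `σ² = 3/π`, that the finite-width
qKZ/IK₁₉ computation of the card must reproduce in the `L → ∞` limit; its exponent part is SSW's
`Δ₆(λ)+Δ₆(-λ) = 3λ²/2π²`, its constant part is new. -/
def TwoPointShadow : Prop :=
  ∀ (f : ℂ → ℝ) (R C : ℝ), Measurable f → (∀ z, |f z| ≤ C) → (∀ z, R < ‖z‖ → f z = 0) →
    ∫ z, f z = 0 →
    Tendsto (fun δ : ℝ ↦ ∫ cfg,
        (3 * (∑ᶠ u ∈ {u : UnbasedLoop ℂ | ∃ (v : HexVertex) (γ : hexGraph.Walk v v),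
              IsSiteInterfaceLoop cfg γ ∧
              u = UnbasedLoop.mk (BasedLoop.mk (siteLoopCurve δ γ) (isLoop_siteLoopCurve δ γ))},
              u.nestingPhase f) ^ 2
          - 4 * ∑ᶠ u ∈ {u : UnbasedLoop ℂ | ∃ (v : HexVertex) (γ : hexGraph.Walk v v),
              IsSiteInterfaceLoop cfg γ ∧
              u = UnbasedLoop.mk (BasedLoop.mk (siteLoopCurve δ γ) (isLoop_siteLoopCurve δ γ))},
              (u.nestingPhase f) ^ 2) ∂(triSitePercolation half))
      (𝓝[>] 0) (𝓝 (3 / (2 * π ^ 2) * ∫ x, ∫ y, Real.log ‖x - y‖ * f x * f y))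

end Summit.CriticalPhenomena.CardyFormulaZ2.Cruxes.MagicFormulaT.Sketch

end
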